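import Summits.QuantumFields.YangMills.Theorems.UnitScaleTiltProp7CombTildLinearResponseOfRegPrT3
import Summits.QuantumFields.YangMills.Theorems.UnitScaleTiltProp7CombPullbackGradDict
import Summits.QuantumFields.YangMills.Theorems.UnitScaleTiltProp7CombTowerWindowsOfRegPrT3
import HarnessLib

/-!
# Route `UnitScaleTilt`, crux K1 «MinimiserStabilityRegPr» (stmt-QuantumFields-19200), LANE II (R-LEGS) — F-9d-c LETTERS «THE MEMBER LETTERS OF THE LINEAR-RESPONSE ROWS»:
# the two displayed rows (hG)∕(hN′) of w4-20520 g12's ⧗p718441 `Prop7RLegsCovKnit.covGradLegs_of_linTower_rows` are statements about ★routeR-w1's linearised cornered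
# tower `Q l (A♯)` summed over ONE period cell — §1 turns their left sides into cell sums of `Q l (A♯)` and their right-side currencies `SA`, `GA` into the level-0 cell
# currencies of `A♯`, BY NAME — the torus-side letters px18 g5's F-9d-c member knit (`…RLegsLinTowerRowsOfRegPr`) imports (px18 g5 13:00:29Z «routeR-w2: file §1–§2»).

Cell `ym3-torus` (HUMAN RULING D-0037: YM₃ on the torus is ladder rung R3 — not d = 4, not a mass gap, not Clay), twin-width seat `ym-routeR-w2` (gen 10); pens of record
★routeR-w1 g10 12:29:20Z (F-9d named; cut a∕b px18 g5, c routeR-w2 g10), px18 g5 12:24:09Z, w4-20520 g12 SPEC #58∕#59.  `--supports stmt-QuantumFields-19200 --as helper`;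
THEOREMS ONLY (0 `def`, 0 `sorry`); count-neutral.  Nothing of (hG), (hN′), (R-LEGS), `hMcomb`, (β), `hPA2`, `hcoS`, E′, EX, the crux, d = 4 or the gap is claimed.

THE POINT.  With `W♯ := pull (bgUnits F K W) x₀`, `A♯ := pull A x₀`, `x₀ := basePt F n K`, `x̂ := tlift x`: at a printed-regular background (`10⁷L³ε₀ ≤ 1`)
* `Y_l x̂ κ := fderiv ℂ (t ↦ ↑(Ũˡ[(e^{t})♯](x̂, κ))) 0 A = Q l (A♯) x̂ κ` for EVERY linearised-tower family `Q` (✓`Prop7CombTildLinearResponseOfRegPr.fderiv_coe_tildIter_eq_linTower_pull_of_regPr`),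
  so the torus sums `Σ_{x : Site (F.P K) l}` of (hN′)∕(hG) are the period-cell sums `Σ_{t : Fin 3 → Fin N_l}` of `‖Q l (A♯)‖²` ∕ of its covariant coarse differences
  (✓F-8a `Prop7CombPeriodCellDict.sum_site_eq_sum_boxVec`);
* `SA = Σ_{t,μ}‖A♯(boxVec N₀ t, μ)‖²` and `GA = Σ_{t,μ,ν}‖Ad_{W♯(t̂,ν)}A♯(t̂+e_ν, μ) − A♯(t̂, μ)‖²` EXACTLY (✓F-8c-1 `Prop7CombPullbackGradDict.sum_cell_normSq_pull_eq` ∕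
  `sum_cell_normSq_covGrad_pull_eq`).
HONEST SCOPE.  Re-indexing over landed rows; no estimate.  Rung R3, not Clay; YM gap NOT proved.

References: T. Bałaban, CMP **98** (1985) 17–51 [Balaban1985Averaging] ((65)∕(68)∕(69) p.29, (119) p.35); CMP **99** (1985) 75–102 [Balaban1985RegularSpaces] ((1.1)–(1.3)
pp.76–77); CMP **109** (1987) 249–301 [Balaban1987RG1] ((0.1) p.251, (0.4) p.253).
-/

set_option autoImplicit false

noncomputable section

open scoped Matrix.Norms.L2Operator BigOperators

namespace Summit.QuantumFields.YangMills.Theorems.Prop7RLegsLinTowerRowsLetters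

open NormedSpace
open Literature.MathematicalPhysics.QuantumFieldTheory.Balaban1983to89
open Literature.MathematicalPhysics.QuantumFieldTheory.Balaban1983to89.T3ContinuumYM3Torus
open T3PrintedRegularMinimiser (RegPr)
open T3SectALandauChart (bgUnits)
open B7Prop1Explicit renaming Site → LSite
open B7Prop1Explicit (e expUnit boxVec Wcx Xavg gammaWord seg)
open B7Prop2Explicit (avgIter)
open B7Eq92Concrete (tildIter)
open B7Eq78Linearization (conjR)
open B7Prop3GeneralRotated (tsum)
open ExpMeanLog (eml)
open T4TermwiseTorus (tlift)
open B10Eq27TorusAxialLog (pull transl)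
open Summit.QuantumFields.YangMills.Theorems.Prop7SPrint (basePt)
open Summit.QuantumFields.YangMills.Theorems.Prop7CombTildLinearResponseOfRegPr (fderiv_coe_tildIter_eq_linTower_pull_of_regPr)
open Summit.QuantumFields.YangMills.Theorems.Prop7CombPeriodCellDict (sum_site_eq_sum_boxVec)
open Summit.QuantumFields.YangMills.Theorems.Prop7CombPullbackGradDict (sum_cell_normSq_pull_eq sum_cell_normSq_covGrad_pull_eq)

variable (F : T3Family) {n K : ℕ}

/-! ## §1 The left sides of (hN′)∕(hG) are period-cell sums of the linearised cornered tower -/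

/-- ★★ **(hN′)'s LEFT SIDE IS A CELL SUM OF `‖Q l (A♯)‖²`**: at `RegPr F n K ε₀ W` with `10⁷L³ε₀ ≤ 1`, for ANY family `Q` with ✓p704390's texts at `(L, W♯)`, every `A`, `l ≤ K − n` and any
name `N` of the level-`l` site count, `Σ_{x : Site (F.P K) l}Σ_κ‖Y_l x̂ κ‖² = Σ_{t : Fin d → Fin N}Σ_κ‖Q l (A♯) (boxVec N t) κ‖²`. [cite: Balaban1985Averaging, (68)-(69) p.29, (119) p.35; Balaban1987RG1, (0.1) p.251] -/
theorem sum_site_normSq_linResponse_eq_cell {ε₀ : ℝ} (hε₀ : 0 < ε₀) (hε : 10 ^ 7 * (F.L : ℝ) ^ 3 * ε₀ ≤ 1)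
    (W : GaugeField (F.P K) 0 (Matrix.specialUnitaryGroup (Fin 2) ℂ)) (hreg : RegPr F n K ε₀ W)
    (Q : ℕ → (LSite (F.P K).d → Fin (F.P K).d → Matrix (Fin 2) (Fin 2) ℂ) → LSite (F.P K).d → Fin (F.P K).d → Matrix (Fin 2) (Fin 2) ℂ) (hQ0 : ∀ Y, Q 0 Y = Y)
    (hQs : ∀ (k : ℕ) (Y : LSite (F.P K).d → Fin (F.P K).d → Matrix (Fin 2) (Fin 2) ℂ) (z : LSite (F.P K).d) (κ : Fin (F.P K).d), Q (k + 1) Y z κ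
        = fderiv ℂ (eml : ((Fin (F.P K).d → Fin (F.P K).L) → Matrix (Fin 2) (Fin 2) ℂ) → Matrix (Fin 2) (Fin 2) ℂ)
              (fun r => ((Wcx (F.P K).L (avgIter (F.P K).L (pull (bgUnits F K W) (basePt F n K)) k) ((((F.P K).L : ℕ) : ℤ) • z) κ (boxVec (F.P K).L r) :
                (Matrix (Fin 2) (Fin 2) ℂ)ˣ) : Matrix (Fin 2) (Fin 2) ℂ))
              (fun r => tsum (avgIter (F.P K).L (pull (bgUnits F K W) (basePt F n K)) k) (Q k Y) ((((F.P K).L : ℕ) : ℤ) • z)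
                  (gammaWord (F.P K).L κ (boxVec (F.P K).L r) ++ seg κ (-(((F.P K).L : ℕ) : ℤ)))
                * ((Wcx (F.P K).L (avgIter (F.P K).L (pull (bgUnits F K W) (basePt F n K)) k) ((((F.P K).L : ℕ) : ℤ) • z) κ (boxVec (F.P K).L r) :
                  (Matrix (Fin 2) (Fin 2) ℂ)ˣ) : Matrix (Fin 2) (Fin 2) ℂ))
              * (((expUnit (Xavg (F.P K).L (avgIter (F.P K).L (pull (bgUnits F K W) (basePt F n K)) k) ((((F.P K).L : ℕ) : ℤ) • z) κ))⁻¹ :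
                (Matrix (Fin 2) (Fin 2) ℂ)ˣ) : Matrix (Fin 2) (Fin 2) ℂ)
            + ((expUnit (Xavg (F.P K).L (avgIter (F.P K).L (pull (bgUnits F K W) (basePt F n K)) k) ((((F.P K).L : ℕ) : ℤ) • z) κ) :
                (Matrix (Fin 2) (Fin 2) ℂ)ˣ) : Matrix (Fin 2) (Fin 2) ℂ)
              * tsum (avgIter (F.P K).L (pull (bgUnits F K W) (basePt F n K)) k) (Q k Y) ((((F.P K).L : ℕ) : ℤ) • z) (seg κ (((F.P K).L : ℕ) : ℤ))
              * (((expUnit (Xavg (F.P K).L (avgIter (F.P K).L (pull (bgUnits F K W) (basePt F n K)) k) ((((F.P K).L : ℕ) : ℤ) • z) κ))⁻¹ :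
                (Matrix (Fin 2) (Fin 2) ℂ)ˣ) : Matrix (Fin 2) (Fin 2) ℂ))
    (A : PBond (F.P K) 0 → Matrix (Fin 2) (Fin 2) ℂ) {l : ℕ} (hl : l ≤ K - n) {N : ℕ} (hN : (F.P K).sitesPerDir l = N) :
    ∑ x : Site (F.P K) l, ∑ κ : Fin (F.P K).d,
        ‖fderiv ℂ (fun t : PBond (F.P K) 0 → Matrix (Fin 2) (Fin 2) ℂ =>
            ((tildIter (F.P K).L (pull (bgUnits F K W) (basePt F n K)) (pull (fun b => expUnit (t b)) (basePt F n K)) l (fun ν => ((x ν).val : ℤ)) κ :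
              (Matrix (Fin 2) (Fin 2) ℂ)ˣ) : Matrix (Fin 2) (Fin 2) ℂ)) 0 A‖ ^ 2
      = ∑ t : Fin (F.P K).d → Fin N, ∑ κ : Fin (F.P K).d, ‖Q l (pull (G := Matrix (Fin 2) (Fin 2) ℂ) A (basePt F n K)) (boxVec N t) κ‖ ^ 2 := by
  rw [← sum_site_eq_sum_boxVec hN (fun z => ∑ κ : Fin (F.P K).d, ‖Q l (pull (G := Matrix (Fin 2) (Fin 2) ℂ) A (basePt F n K)) z κ‖ ^ 2)]
  refine Finset.sum_congr rfl fun x _ => Finset.sum_congr rfl fun κ _ => ?_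
  rw [fderiv_coe_tildIter_eq_linTower_pull_of_regPr F hε₀ hε W hreg Q hQ0 hQs A hl _ κ]
  rfl

/-- ★★ **(hG)'s LEFT SIDE IS A CELL SUM OF THE COVARIANT COARSE DIFFERENCES OF `Q l (A♯)`** (same hypotheses; per coarse direction `μ`).
[cite: Balaban1985Averaging, (68)-(69) p.29, (119) p.35, (43) p.24; Balaban1987RG1, (0.1) p.251] -/
theorem sum_site_normSq_covGrad_linResponse_eq_cell {ε₀ : ℝ} (hε₀ : 0 < ε₀) (hε : 10 ^ 7 * (F.L : ℝ) ^ 3 * ε₀ ≤ 1)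
    (W : GaugeField (F.P K) 0 (Matrix.specialUnitaryGroup (Fin 2) ℂ)) (hreg : RegPr F n K ε₀ W)
    (Q : ℕ → (LSite (F.P K).d → Fin (F.P K).d → Matrix (Fin 2) (Fin 2) ℂ) → LSite (F.P K).d → Fin (F.P K).d → Matrix (Fin 2) (Fin 2) ℂ) (hQ0 : ∀ Y, Q 0 Y = Y)
    (hQs : ∀ (k : ℕ) (Y : LSite (F.P K).d → Fin (F.P K).d → Matrix (Fin 2) (Fin 2) ℂ) (z : LSite (F.P K).d) (κ : Fin (F.P K).d), Q (k + 1) Y z κ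
        = fderiv ℂ (eml : ((Fin (F.P K).d → Fin (F.P K).L) → Matrix (Fin 2) (Fin 2) ℂ) → Matrix (Fin 2) (Fin 2) ℂ)
              (fun r => ((Wcx (F.P K).L (avgIter (F.P K).L (pull (bgUnits F K W) (basePt F n K)) k) ((((F.P K).L : ℕ) : ℤ) • z) κ (boxVec (F.P K).L r) :
                (Matrix (Fin 2) (Fin 2) ℂ)ˣ) : Matrix (Fin 2) (Fin 2) ℂ))
              (fun r => tsum (avgIter (F.P K).L (pull (bgUnits F K W) (basePt F n K)) k) (Q k Y) ((((F.P K).L : ℕ) : ℤ) • z)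
                  (gammaWord (F.P K).L κ (boxVec (F.P K).L r) ++ seg κ (-(((F.P K).L : ℕ) : ℤ)))
                * ((Wcx (F.P K).L (avgIter (F.P K).L (pull (bgUnits F K W) (basePt F n K)) k) ((((F.P K).L : ℕ) : ℤ) • z) κ (boxVec (F.P K).L r) :
                  (Matrix (Fin 2) (Fin 2) ℂ)ˣ) : Matrix (Fin 2) (Fin 2) ℂ))
              * (((expUnit (Xavg (F.P K).L (avgIter (F.P K).L (pull (bgUnits F K W) (basePt F n K)) k) ((((F.P K).L : ℕ) : ℤ) • z) κ))⁻¹ :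
                (Matrix (Fin 2) (Fin 2) ℂ)ˣ) : Matrix (Fin 2) (Fin 2) ℂ)
            + ((expUnit (Xavg (F.P K).L (avgIter (F.P K).L (pull (bgUnits F K W) (basePt F n K)) k) ((((F.P K).L : ℕ) : ℤ) • z) κ) :
                (Matrix (Fin 2) (Fin 2) ℂ)ˣ) : Matrix (Fin 2) (Fin 2) ℂ)
              * tsum (avgIter (F.P K).L (pull (bgUnits F K W) (basePt F n K)) k) (Q k Y) ((((F.P K).L : ℕ) : ℤ) • z) (seg κ (((F.P K).L : ℕ) : ℤ))
              * (((expUnit (Xavg (F.P K).L (avgIter (F.P K).L (pull (bgUnits F K W) (basePt F n K)) k) ((((F.P K).L : ℕ) : ℤ) • z) κ))⁻¹ :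
                (Matrix (Fin 2) (Fin 2) ℂ)ˣ) : Matrix (Fin 2) (Fin 2) ℂ))
    (A : PBond (F.P K) 0 → Matrix (Fin 2) (Fin 2) ℂ) {l : ℕ} (hl : l ≤ K - n) {N : ℕ} (hN : (F.P K).sitesPerDir l = N) (μ : Fin (F.P K).d) :
    ∑ x : Site (F.P K) l, ∑ κ : Fin (F.P K).d,
        ‖fderiv ℂ (fun t : PBond (F.P K) 0 → Matrix (Fin 2) (Fin 2) ℂ =>
              ((tildIter (F.P K).L (pull (bgUnits F K W) (basePt F n K)) (pull (fun b => expUnit (t b)) (basePt F n K)) l (fun ν => ((x ν).val : ℤ)) κ :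
                (Matrix (Fin 2) (Fin 2) ℂ)ˣ) : Matrix (Fin 2) (Fin 2) ℂ)) 0 A
          - conjR (avgIter (F.P K).L (pull (bgUnits F K W) (basePt F n K)) l (fun ν => ((x ν).val : ℤ)) μ)
            (fderiv ℂ (fun t : PBond (F.P K) 0 → Matrix (Fin 2) (Fin 2) ℂ =>
              ((tildIter (F.P K).L (pull (bgUnits F K W) (basePt F n K)) (pull (fun b => expUnit (t b)) (basePt F n K)) l ((fun ν => ((x ν).val : ℤ)) + B7Prop1Explicit.e μ) κ :
                (Matrix (Fin 2) (Fin 2) ℂ)ˣ) : Matrix (Fin 2) (Fin 2) ℂ)) 0 A)‖ ^ 2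
      = ∑ t : Fin (F.P K).d → Fin N, ∑ κ : Fin (F.P K).d,
          ‖Q l (pull (G := Matrix (Fin 2) (Fin 2) ℂ) A (basePt F n K)) (boxVec N t) κ
            - conjR (avgIter (F.P K).L (pull (bgUnits F K W) (basePt F n K)) l (boxVec N t) μ)
                (Q l (pull (G := Matrix (Fin 2) (Fin 2) ℂ) A (basePt F n K)) (boxVec N t + e μ) κ)‖ ^ 2 := by
  rw [← sum_site_eq_sum_boxVec hN (fun z => ∑ κ : Fin (F.P K).d,
    ‖Q l (pull (G := Matrix (Fin 2) (Fin 2) ℂ) A (basePt F n K)) z κ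
      - conjR (avgIter (F.P K).L (pull (bgUnits F K W) (basePt F n K)) l z μ) (Q l (pull (G := Matrix (Fin 2) (Fin 2) ℂ) A (basePt F n K)) (z + e μ) κ)‖ ^ 2)]
  refine Finset.sum_congr rfl fun x _ => Finset.sum_congr rfl fun κ _ => ?_
  rw [fderiv_coe_tildIter_eq_linTower_pull_of_regPr F hε₀ hε W hreg Q hQ0 hQs A hl _ κ,
    fderiv_coe_tildIter_eq_linTower_pull_of_regPr F hε₀ hε W hreg Q hQ0 hQs A hl _ κ]
  rfl

/-! ## §2 The right-side currencies `SA`, `GA` are the level-0 cell currencies of `A♯` (✓F-8c-1, re-exported at the base point) -/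

/-- **`SA` ON THE CELL**: `Σ_{t,μ}‖A♯(boxVec N₀ t, μ)‖² = Σ_b‖A b‖²` (✓`Prop7CombPullbackGradDict.sum_cell_normSq_pull_eq` at `y := basePt`). [cite: Balaban1985RegularSpaces, (1.3) p.77] -/
theorem cell_mass_eq_SA {N₀ : ℕ} (hN₀ : (F.P K).sitesPerDir 0 = N₀) (A : PBond (F.P K) 0 → Matrix (Fin 2) (Fin 2) ℂ) :
    ∑ t : Fin (F.P K).d → Fin N₀, ∑ μ : Fin (F.P K).d, ‖pull (G := Matrix (Fin 2) (Fin 2) ℂ) A (basePt F n K) (boxVec N₀ t) μ‖ ^ 2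
      = ∑ b : PBond (F.P K) 0, ‖A b‖ ^ 2 :=
  sum_cell_normSq_pull_eq F K hN₀ A (basePt F n K)

/-- **`GA` ON THE CELL**: the period-cell covariant-gradient currency of `A♯` along `W♯` is the torus sum `Σ_{b,ν}‖W(b.src,ν)·A(b.src+e_ν, b.dir)·W(b.src,ν)* − A b‖²`
(✓`Prop7CombPullbackGradDict.sum_cell_normSq_covGrad_pull_eq` at `y := basePt`). [cite: Balaban1985RegularSpaces, (1.1)-(1.3) pp.76-77] -/
theorem cell_covGrad_eq_GA {N₀ : ℕ} (hN₀ : (F.P K).sitesPerDir 0 = N₀) (W : GaugeField (F.P K) 0 (Matrix.specialUnitaryGroup (Fin 2) ℂ))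
    (A : PBond (F.P K) 0 → Matrix (Fin 2) (Fin 2) ℂ) :
    ∑ t : Fin (F.P K).d → Fin N₀, ∑ μ : Fin (F.P K).d, ∑ ν : Fin (F.P K).d,
        ‖conjR (pull (bgUnits F K W) (basePt F n K) (boxVec N₀ t) ν) (pull (G := Matrix (Fin 2) (Fin 2) ℂ) A (basePt F n K) (boxVec N₀ t + e ν) μ)
            - pull (G := Matrix (Fin 2) (Fin 2) ℂ) A (basePt F n K) (boxVec N₀ t) μ‖ ^ 2
      = ∑ b : PBond (F.P K) 0, ∑ ν : Fin (F.P K).d,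
        ‖((W ⟨b.src, ν⟩ : Matrix.specialUnitaryGroup (Fin 2) ℂ) : Matrix (Fin 2) (Fin 2) ℂ) * A ⟨b.src.shift ν, b.dir⟩
            * star ((W ⟨b.src, ν⟩ : Matrix.specialUnitaryGroup (Fin 2) ℂ) : Matrix (Fin 2) (Fin 2) ℂ) - A b‖ ^ 2 :=
  sum_cell_normSq_covGrad_pull_eq F K hN₀ W A (basePt F n K)

end Summit.QuantumFields.YangMills.Theorems.Prop7RLegsLinTowerRowsLetters

end
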